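import Literature.Geometry.DiscreteGeometry.ThreePointKernel
import Literature.Geometry.DiscreteGeometry.LegendreThreePSD

/-!
# Three-point positivity on `S³` with the Legendre kernel (Bachoc–Vallentin's `Y_k`, `n = 4`)

The genuine Bachoc–Vallentin kernels for `S³ ⊂ ℝ⁴` (BV 2008, Theorem 3.2 with `n = 4`):
`Q_k(u,v,t) = ((1-u²)(1-v²))^{k/2} P_k((t-uv)/√((1-u²)(1-v²)))` with `P_k = P_k^{(3)}` the Legendre
polynomial, here in the integer normalisation `QkP k u v t = legendreI k (t - uv) ((1-u²)(1-v²))`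
(`= 2^k Q_k`). Positivity around a fixed unit vector `z` (BV Thm 3.1(d), Cor 3.5):
`Σ_{i,j} c_i c_j QkP k (z·p_i) (z·p_j) (p_i·p_j) ≥ 0` for unit `p_i`, every degree `k`.

Proof: the right quaternion frame `z·i, z·j, z·k` is an orthonormal basis of `z^⊥`; the coordinate
map `frame3 z : ℝ⁴ → ℝ³` satisfies `⟨frame3 z x, frame3 z y⟩ = x·y - (z·x)(z·y)` and
`‖frame3 z x‖² = 1 - (z·x)²` for unit `x, y, z` (Parseval), so the kernel is the Legendre kernel of
`ℝ³` evaluated at the frames, and `sum_sum_legendreI_nonneg` applies.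

## References
* C. Bachoc, F. Vallentin, *New upper bounds for kissing numbers from semidefinite programming*,
  J. Amer. Math. Soc. 21 (2008), Theorem 3.2, Corollary 3.5. [`BachocVallentin2007`]
-/

noncomputable section

open scoped RealInnerProductSpace

namespace Literature.Geometry.DiscreteGeometry

/-- Local notation for `ℝ⁴ = EuclideanSpace ℝ (Fin 4)`. -/
local notation "E⁴" => EuclideanSpace ℝ (Fin 4)
/-- Local notation for `ℝ³ = EuclideanSpace ℝ (Fin 3)`. -/
local notation "E³" => EuclideanSpace ℝ (Fin 3)

/-- Bachoc–Vallentin's three-point kernel for `S³` with the Legendre polynomial, integer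
normalisation: `QkP k u v t = legendreI k (t - uv) ((1-u²)(1-v²)) = 2^k Q_k^{(3)}(u,v,t)`.
[cite: BachocVallentin2007, Theorem 3.2] -/
def QkP (k : ℕ) (u v t : ℝ) : ℝ := legendreI k (t - u * v) ((1 - u ^ 2) * (1 - v ^ 2))

/-- Coordinates of `x` in the right quaternion frame `(z·i, z·j, z·k)` of `z^⊥`:
`z·i = (-z₁, z₀, z₃, -z₂)`, `z·j = (-z₂, -z₃, z₀, z₁)`, `z·k = (-z₃, z₂, -z₁, z₀)`. [folklore] -/
def frame3 (z x : E⁴) : E³ :=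
  !₂[-(z 1) * x 0 + z 0 * x 1 + z 3 * x 2 - z 2 * x 3,
     -(z 2) * x 0 - z 3 * x 1 + z 0 * x 2 + z 1 * x 3,
     -(z 3) * x 0 + z 2 * x 1 - z 1 * x 2 + z 0 * x 3]

/-- Coordinates of the inner product on `ℝ⁴`. [folklore] -/
theorem inner_four (x y : E⁴) :
    inner ℝ x y = x 0 * y 0 + x 1 * y 1 + x 2 * y 2 + x 3 * y 3 := by
  simp [PiLp.inner_apply, Fin.sum_univ_four, mul_comm]

/-- `‖x‖² = Σ x_i²` on `ℝ⁴`. [folklore] -/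
theorem norm_sq_four (x : E⁴) : ‖x‖ ^ 2 = x 0 ^ 2 + x 1 ^ 2 + x 2 ^ 2 + x 3 ^ 2 := by
  rw [EuclideanSpace.real_norm_sq_eq, Fin.sum_univ_four]

/-- Parseval in the frame `(z, z·i, z·j, z·k)`:
`‖z‖² (x·y) = (z·x)(z·y) + ⟨frame3 z x, frame3 z y⟩`. [folklore] -/
theorem inner_frame3 (z x y : E⁴) :
    inner ℝ (frame3 z x) (frame3 z y) = ‖z‖ ^ 2 * inner ℝ x y - inner ℝ z x * inner ℝ z y := by
  have inner_three : ∀ a b : E³, inner ℝ a b = a 0 * b 0 + a 1 * b 1 + a 2 * b 2 := by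
    intro a b; simp [PiLp.inner_apply, Fin.sum_univ_three, mul_comm]
  rw [norm_sq_four, inner_four, inner_four, inner_four, inner_three]
  simp only [frame3, PiLp.toLp_apply, Matrix.cons_val_zero, Matrix.cons_val_one,
    Matrix.cons_val_two, Matrix.head_cons, Matrix.tail_cons]
  ring

/-- For unit vectors: `⟨frame3 z x, frame3 z y⟩ = x·y - (z·x)(z·y)`. [folklore] -/
theorem inner_frame3_unit (z x y : E⁴) (hz : ‖z‖ = 1) :
    inner ℝ (frame3 z x) (frame3 z y) = inner ℝ x y - inner ℝ z x * inner ℝ z y := by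
  rw [inner_frame3, hz]; ring

/-- For unit vectors: `‖frame3 z x‖² = 1 - (z·x)²`. [folklore] -/
theorem norm_sq_frame3_unit (z x : E⁴) (hz : ‖z‖ = 1) (hx : ‖x‖ = 1) :
    ‖frame3 z x‖ ^ 2 = 1 - inner ℝ z x ^ 2 := by
  rw [← real_inner_self_eq_norm_sq, inner_frame3_unit z x x hz, real_inner_self_eq_norm_sq, hx]
  ring

/-- `QkP k (z·x) (z·y) (x·y)` is the Legendre kernel of `ℝ³` at the frame coordinates.
[cite: BachocVallentin2007, Theorem 3.2] -/
theorem QkP_inner_eq (k : ℕ) (z x y : E⁴) (hz : ‖z‖ = 1) (hx : ‖x‖ = 1) (hy : ‖y‖ = 1) :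
    QkP k (inner ℝ z x) (inner ℝ z y) (inner ℝ x y) =
      legendreI k (inner ℝ (frame3 z x) (frame3 z y)) (‖frame3 z x‖ ^ 2 * ‖frame3 z y‖ ^ 2) := by
  rw [QkP, inner_frame3_unit z x y hz, norm_sq_frame3_unit z x hz hx, norm_sq_frame3_unit z y hz hy]

/-- **Positivity of the Legendre three-point kernel around a fixed point** (BV 2008,
Thm 3.1(d)/Cor 3.5, `n = 4`, every degree `k`). [cite: BachocVallentin2007, Corollary 3.5] -/
theorem sum_sum_QkP_nonneg (k : ℕ) (z : E⁴) (hz : ‖z‖ = 1) {ι : Type*}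
    (s : Finset ι) (c : ι → ℝ) (p : ι → E⁴) (hp : ∀ i ∈ s, ‖p i‖ = 1) :
    0 ≤ ∑ i ∈ s, ∑ j ∈ s,
      c i * c j * QkP k (inner ℝ z (p i)) (inner ℝ z (p j)) (inner ℝ (p i) (p j)) := by
  have h := sum_sum_legendreI_nonneg k s c (fun i => frame3 z (p i))
  have heq : ∀ i ∈ s, ∀ j ∈ s,
      c i * c j * legendreI k (inner ℝ (frame3 z (p i)) (frame3 z (p j)))
        (‖frame3 z (p i)‖ ^ 2 * ‖frame3 z (p j)‖ ^ 2) =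
      c i * c j * QkP k (inner ℝ z (p i)) (inner ℝ z (p j)) (inner ℝ (p i) (p j)) := by
    intro i hi j hj
    rw [QkP_inner_eq k z (p i) (p j) hz (hp i hi) (hp j hj)]
  rwa [Finset.sum_congr rfl fun i hi => Finset.sum_congr rfl fun j hj => heq i hi j hj] at h

/-- The `Y`-form with the Legendre kernel: `φ_w(u) φ_w(v) QkP k u v t`.
[cite: BachocVallentin2007, Theorem 3.2 and Remark 3.4] -/
def YformP (k : ℕ) (w : List ℝ) (u v t : ℝ) : ℝ := polyW w u * polyW w v * QkP k u v t

/-- **Three-point positivity with the Legendre kernel** (BV 2008, (pos S)/Cor 3.5, `n = 4`):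
`Σ_{x,y,z ∈ C} wᵀ Y_k(z·x, z·y, x·y) w ≥ 0`, every degree `k`.
[cite: BachocVallentin2007, Corollary 3.5] -/
theorem sum3_YformP_nonneg (k : ℕ) (w : List ℝ) (C : Finset E⁴)
    (hC : ∀ x ∈ C, ‖x‖ = 1) :
    0 ≤ ∑ z ∈ C, ∑ x ∈ C, ∑ y ∈ C, YformP k w (inner ℝ z x) (inner ℝ z y) (inner ℝ x y) := by
  refine Finset.sum_nonneg fun z hz => ?_
  have h := sum_sum_QkP_nonneg k z (hC z hz) C (fun x => polyW w (inner ℝ z x)) (fun x => x) hC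
  simpa only [YformP] using h

end Literature.Geometry.DiscreteGeometry

end
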